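import Summits.AtomisticToContinuum.Crystallization.Theorems.SquareWellLayerCakeStackingFaultSparsityOfGapTwelve
import Summits.AtomisticToContinuum.Crystallization.Theorems.SquareWellLayerCakeStackingFaultSparsityIffCoarsening

/-!
# Crux stmt-AtomisticToContinuum-14296 `StackingFaultSparsity` — strategist r1 (redirect seat):
# the theorems that PLACE the crux (domination + vacuity sandwich), kernel-checked

Route in hand: `route-AtomisticToContinuum-SquareWellLayerCake` (the crux is shared verbatim with
`LaminarSixThreeThree`; `Defs.stackingFaultSparsity_iff / _iff'` are `Iff.rfl` for the two copies).
Write SFS for the crux, LBW for `SquareWellLayerCake.LaminarBarlowWindows` (item 14292, the a.e. all-scale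
Barlow order of LJ ground states), K1/K2/K3 for the route's other cruxes `AveragedTwelve`, `TwelveWithinOne`,
`GapTwelveToBarlow`, and S for the sub-problem statement `Crystallization`.

This file certifies, over LANDED theorems only (no `sorry`):

* §1 DOMINATION (tribunal T1(a): a hypothesis `H ⇒ SFS` with `H ⇒ S` alone).
  - `sfs_of_laminarBarlowWindows : LBW → SFS` (landed p141795, re-exported);
  - `crystallization_of_laminarBarlowWindows : LBW → S` (NEW composition here: Steps 3–4 of the route's
    `closes` with its `hS` discharged by p141795) — so the ONLY typed supplier of SFS in the tree is
    summit-strength (indeed strictly stronger than S: it fixes the polytype class and is a full-sequence,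
    almost-everywhere statement, while S asks for one periodic local limit along a subsequence);
  - `sfs_of_routeCruxes : K1 → K2 → K3 → SFS` and `crystallization_of_routeCruxes : K1 → K2 → K3 → S`
    (landed p142202, re-exported): inside route `SquareWellLayerCake` the crux is dominated by the route's
    OTHER three cruxes — it is not an independent load-bearing hypothesis of `closes`.
* §2 VACUITY SANDWICH. `sfs_of_noBarlowWindows : NoBarlowWindows → SFS`: the crux ALSO follows from the
  total ABSENCE of Barlow order at positive density (an amorphous / icosahedral bulk satisfies SFS
  vacuously).  Together with §1: SFS is implied both by "crystalline (Barlow) a.e." and by "crystalline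
  nowhere", so SFS carries no information toward S (`SFS → S` cannot be proved short of proving S), and its
  whole open content is the MIXED regime — faulted Barlow micro-order coexisting with positive-density
  non-Barlow bulk (`stackingFaultSparsity_iff_faultedGrainCoarsening`, p144965, + Disproof §7
  `cuboConfig_centre_counted`: cuboctahedral first shells floating in an arbitrary bulk must be `o(N)`).
  Deciding the mixed regime needs a structure theorem for the non-Barlow bulk of exact LJ minimisers; the
  only candidates anyone can type are LBW-type statements, which are ≥ S (§1).
* §3 RE-GLUE SHAPE for the tenure planner of `SquareWellLayerCake` (not an edit — strategists do not touch
  `closes`): `closes_shape_without_sfs : K1 → K2 → K3 → (LBW → SFS) → S`, i.e. the deciding theorem with the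
  crux binder replaced by the PROVED selection step; see REGLUE-READY.md for the commands.

Everything `[folklore]` glue; axioms `propext, Classical.choice, Quot.sound`.
-/

noncomputable section

open Filter
open scoped Topology

namespace Summit.AtomisticToContinuum.Crystallization.Cruxes.StackingFaultSparsity.DominationR1

open Literature.MathematicalPhysics.StatisticalMechanics
open Summit.AtomisticToContinuum.Crystallization.Theses
open Summit.AtomisticToContinuum.Crystallization.Theorems.SquareWellLayerCake.StackingFaultSparsity
open Summit.AtomisticToContinuum.Crystallization.Theorems.SquareWellLayerCake.StackingFaultSparsity.OfLaminarBarlowWindows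

/-! ## §1 Domination -/

/-- `LBW → SFS` (landed, p141795; line `Sketch` closed modulo X). [folklore] -/
theorem sfs_of_laminarBarlowWindows :
    SquareWellLayerCake.LaminarBarlowWindows → SquareWellLayerCake.StackingFaultSparsity :=
  StackingFaultSparsity_of_laminarBarlowWindows

/-- **`LBW → Crystallization`**: the only typed supplier of the crux decides the sub-problem ON ITS OWN
(Steps 3–4 of `SquareWellLayerCake.closes`, with `StackingFaultSparsity` discharged by p141795; the energetic
conjunct from the landed `windowOptimality_proof` + `crysEnergyLimit_proof`). Hence a bridge split
`SFS ⇐ {LBW, LBW → SFS}` fails BC2(c) ("T must not give S alone"), and T1(a) places the crux. [folklore] -/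
theorem crystallization_of_laminarBarlowWindows
    (hLBW : SquareWellLayerCake.LaminarBarlowWindows) : _root_.Crystallization := by
  have hLBW' : LaminarSixThreeThree.LaminarBarlowWindows := hLBW
  have hSFS : LaminarSixThreeThree.StackingFaultSparsity := sfs_of_laminarBarlowWindows hLBW
  have hHcpW := Summit.AtomisticToContinuum.Crystallization.Theorems.barlowToHcpWindows_proof hLBW' hSFS
  have hPW := Summit.AtomisticToContinuum.Crystallization.Theorems.hcpWindowsToPeriodicWindows_proof hHcpW
  have hpos : IsCrystallizing lennardJones 3 :=
    Summit.AtomisticToContinuum.Crystallization.Theorems.PrestressSplitKorn.stub_hullCriterion hPW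
  obtain ⟨x0, hx0⟩ : ∃ x : (N : ℕ) → (Fin N → EuclideanSpace ℝ (Fin 3)),
      ∀ N, IsGroundState lennardJones (x N) :=
    ⟨fun N => (LennardJonesGroundStatesExist_holds N).choose,
      fun N => (LennardJonesGroundStatesExist_holds N).choose_spec⟩
  obtain ⟨P, hP⟩ := hPW x0 hx0
  have hleast : IsLeast (Set.range fun Q : PeriodicConfiguration 3 => Q.energyPerParticle lennardJones)
      (P.energyPerParticle lennardJones) :=
    Summit.AtomisticToContinuum.Crystallization.Theorems.windowOptimality_proof x0 hx0 P hP
  have hinf : (⨅ Q : PeriodicConfiguration 3, Q.energyPerParticle lennardJones) =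
      P.energyPerParticle lennardJones :=
    hleast.csInf_eq
  have hlim : Tendsto (fun N : ℕ => groundStateEnergy lennardJones 3 N / N) atTop
      (𝓝 (P.energyPerParticle lennardJones)) := by
    have h0 : Tendsto (fun N : ℕ => groundStateEnergy lennardJones 3 N / N) atTop
        (𝓝 (⨅ Q : PeriodicConfiguration 3, Q.energyPerParticle lennardJones)) :=
      Summit.AtomisticToContinuum.Crystallization.Theorems.crysEnergyLimit_proof
    rw [hinf] at h0
    exact h0
  exact ⟨⟨P, hleast, hlim⟩, hpos⟩

/-- In-route domination, part 1: `K1 → K2 → K3 → SFS` (landed, p142202). [folklore] -/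
theorem sfs_of_routeCruxes :
    SquareWellLayerCake.AveragedTwelve → SquareWellLayerCake.TwelveWithinOne →
      SquareWellLayerCake.GapTwelveToBarlow → SquareWellLayerCake.StackingFaultSparsity :=
  StackingFaultSparsity_of_gapTwelve

/-- In-route domination, part 2: `K1 → K2 → K3 → Crystallization` (landed, p142202) — the route closes
WITHOUT the crux; `closes` consumes `hS` only because it was written before p141795 landed. [folklore] -/
theorem crystallization_of_routeCruxes :
    SquareWellLayerCake.AveragedTwelve → SquareWellLayerCake.TwelveWithinOne →
      SquareWellLayerCake.GapTwelveToBarlow → _root_.Crystallization :=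
  crystallization_of_gapTwelve

/-! ## §2 Vacuity sandwich: the crux also follows from the ABSENCE of Barlow order -/

/-- **Anti-order**: at every scale `(R, ε)`, along every sequence of LJ ground states, the sites that
HAVE an `(R, ε)`-window on some Barlow stacking have density `→ 0` (an amorphous, icosahedral or otherwise
non-close-packed bulk). Nobody believes it for Lennard-Jones; it is stated to locate the content of the
crux. [new] -/
def NoBarlowWindows : Prop :=
  ∀ R ε : ℝ, 0 < R → 0 < ε → ε < 1 / 4 → ∀ x : (N : ℕ) → (Fin N → EuclideanSpace ℝ (Fin 3)),
    (∀ N, IsGroundState lennardJones (x N)) →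
      Tendsto (fun N : ℕ => (Nat.card {i : Fin N // BarlowM R ε (x N) i} : ℝ) / N) atTop (𝓝 0)

/-- **`NoBarlowWindows → SFS`**: the counted set `{Barlow-matched ∧ ¬ hcp-matched}` is a subset of the
Barlow-matched set (monotonicity of the density, `tendsto_density_mono`). With §1: SFS ⇐ LBW and
SFS ⇐ NoBarlowWindows — the crux is decided identically by "Barlow order a.e." and by "Barlow order
nowhere", so it is NOT ≥ S and not ≤ S; its open content is the mixed regime only. [new] -/
theorem sfs_of_noBarlowWindows (h : NoBarlowWindows) : SquareWellLayerCake.StackingFaultSparsity := by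
  rw [← stackingFaultSparsity_iff]
  intro R ε hR hε hε' x hx
  exact tendsto_density_mono (fun N i hi => hi.1) (h R ε hR hε hε' x hx)

/-- The same for the home copy of the shared item (`LaminarSixThreeThree`). [new] -/
theorem sfs_of_noBarlowWindows' (h : NoBarlowWindows) : LaminarSixThreeThree.StackingFaultSparsity :=
  sfs_of_noBarlowWindows h

/-! ## §3 Re-glue shape (for the tenure planner; nothing is edited here) -/

/-- **`closes` without the crux binder**: K1–K3 plus the PROVED selection step `LBW → SFS` decide S
(the hypothesis `hSel` is discharged by `sfs_of_laminarBarlowWindows`; it is kept as a binder to show the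
exact shape a cycle-free route file can use — the landed proof of `LBW → SFS` imports the route file, so
the route file cannot call it, but it CAN take it as a support item closed record-only). [folklore] -/
theorem closes_shape_without_sfs
    (hK1 : SquareWellLayerCake.AveragedTwelve) (hK2 : SquareWellLayerCake.TwelveWithinOne)
    (hK3 : SquareWellLayerCake.GapTwelveToBarlow)
    (hSel : SquareWellLayerCake.LaminarBarlowWindows → SquareWellLayerCake.StackingFaultSparsity) :
    _root_.Crystallization :=
  SquareWellLayerCake.closes hK1 hK2 hK3 (hSel (laminarBarlowWindows_of_gapTwelve hK1 hK2 hK3))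

/-- … and the binder is dischargeable today. [folklore] -/
theorem closes_without_sfs
    (hK1 : SquareWellLayerCake.AveragedTwelve) (hK2 : SquareWellLayerCake.TwelveWithinOne)
    (hK3 : SquareWellLayerCake.GapTwelveToBarlow) : _root_.Crystallization :=
  closes_shape_without_sfs hK1 hK2 hK3 sfs_of_laminarBarlowWindows

end Summit.AtomisticToContinuum.Crystallization.Cruxes.StackingFaultSparsity.DominationR1

end
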